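import Summits.QuantumFields.YangMills.Theorems.BalabanUVNodesN21ChartExponentAnalyticU1

/-!
# N21 (NE7c) · THE `U(1)` MODEL INSTANCE OF THE ANALYTIC ROAD, FILE 3b: the RATE COMPARISON with the real-variable
# second-order row, the analytic clause at print's bookkeeping («for g_k sufficiently small»), and the A6 ∕ A2 witness

Width seat pub-ymgap-dag-n21-w5 (g2; director-ym R399 (3a) ∕ №209 second wave, dag-lead WIDTH-209), node N21 = NE7c
(single-run shell-weight bound, NOT PRINTED in [Bałaban 1983–89], NOT proved), lane K3⁷ `SpineGivenEndpointR13SepCoPH`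
(stmt-QuantumFields-20544, `--kind proof --supports … --as helper`).  Second half of the located hand «P2-U1A» of WIDTH-209
N21 piece 2 (pen dag-n21-w3 g3, bus I.29953); FILE 3a = `…N21ChartExponentAnalyticU1` (★★★
`convexOn_chartExponentU1_analytic`: the abelian (1.2) exponent CONVEX by dag-n21-w3's analytic road ★★′, with the sup
letter `S(g, Φ, r) = g·(Φ + c_H r)³·e^{g(Φ + c_H r)}·Z` of the complexified remainder).

WHAT.
* §4 THE RATE COMPARISON with the real-variable road (p606810 ∕ p607837, `Mq = gΦc_φ` computed by hand): from the same data
  (row-sum letter `Σ_b |H_{pb}| ≤ c_H`, `Σ_p ζ_p ≤ Z`) the real road's comparison letter is `c_φ = Z·c_H²`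
  (`sum_sq_mulVec_le`), so its second-order letter reads `g·Φ·Z·c_H²`; Cauchy's letter `2S∕r²` at the window radius
  `r = Φ∕c_H` is EXACTLY `16·e^{2gΦ}·(g·Φ·Z·c_H²)` (`cauchyLetter_eq`), `≤ 16e·(g·Φ·Z·c_H²)` under the real road's own cap
  `2gΦ ≤ 1` (`cauchyLetter_le_realLetter`) — the SAME RATE `g¹·Φ`; the analytic road pays a numerical factor `16e ≈ 43.5`
  and a diameter letter for not computing the second-order row.  Then the analytic clause at print's bookkeeping
  `Φ ≤ K·p₀(g_k)` as a `g`-smallness line (`analyticClauseU1_of_smallness`), its `∀ᶠ g → 0⁺` form when `g·p₀(g)³ → 0`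
  (`eventually_analyticSmallnessU1`: *"for g_k sufficiently small"*), and ★★★′ = ★★★ at those letters.
* §5 A6 (director-ym №189 (3)) ∕ A2 for ★★′: EVERY binder of ★★★ — analyticity on the complex `r`-balls, the VALUE row
  there, the diameter letter, the clause — JOINTLY INHABITED by the one-plaquette lattice cosine action (`g = 1∕400`, `r = 3`
  about the closed unit ball): ★★′'s NODE-O-shaped clause is satisfiable at a genuine lattice action, with room.

HONEST FRAMING.  [textbook] real inequalities + composition BY NAME over the tree's `U(1)` MODEL INSTANCE; the identification
of `(Φ ≤ K·p₀(g_k), r, Z, c_H)` with [LF-II]'s letters is LOCATED typing, NOT asserted; abelian only; nothing of Bałaban's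
asserted; (M1) ∕ NE7c NOT PRINTED ∕ NOT proved; N21 NOT discharged; K3⁷ NOT claimed; counts unmoved (typed 28∕28 ·
discharged 5∕27); count-neutral; one finite 𝕋⁴ at fixed ε — R4 would close only the conditional finite-𝕋⁴ rung
`BalabanLadder.UV`, NOT the Yang–Mills mass gap (Clay); nothing about ℝ⁴ ∕ OS.  THEOREMS ONLY: 0 `def`, 0 `sorry`.
-/

set_option autoImplicit false

open Real Finset Set Matrix Metric

namespace Summit.QuantumFields.YangMills.Theorems.N21ChartExponentAnalyticU1Rates

open Literature.MathematicalPhysics.QuantumFieldTheory.Balaban1983to89.B16Txt357ThirdOrderU1 (V12)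
open Literature.MathematicalPhysics.QuantumFieldTheory.Balaban1983to89.B16Sect1Wilson (Ineq19)
open Summit.QuantumFields.YangMills.Theorems.N21ChartExponentAnalyticU1 (convexOn_chartExponentU1_analytic)

section Rates

variable {κ : Type*} [Fintype κ] {ι : Type*} [Fintype ι]

/-! ## §4  The rate comparison with the real-variable road (p606810 ∕ p607837: `Mq = gΦc_φ`) -/

/-- **THE REAL ROAD's COMPARISON LETTER FROM THE SAME DATA**: with the row-sum letter `Σ_b |H_{pb}| ≤ c_H` and
`Σ_p ζ_p ≤ Z` (`ζ ≥ 0`), the plaquette form is dominated by the sup norm, `Σ_p ζ_p((H *ᵥ u)_p)² ≤ (Z·c_H²)·‖u‖²` — i.e.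
p607837's `hcφ` holds with `c_φ := Z·c_H²`, and the real-variable road's second-order letter reads `Mq = g·Φ·Z·c_H²`.
[textbook] -/
theorem sum_sq_mulVec_le {cH Z : ℝ} {ζ : ι → ℝ} (hζ : ∀ p, 0 ≤ ζ p) (hZ : ∑ p, ζ p ≤ Z) (H : Matrix ι κ ℝ)
    (hH : ∀ p, ∑ b, |H p b| ≤ cH) (u : κ → ℝ) :
    ∑ p, ζ p * ((H *ᵥ u) p) ^ 2 ≤ Z * cH ^ 2 * ‖u‖ ^ 2 := by
  have hcH : ∀ p, |(H *ᵥ u) p| ≤ cH * ‖u‖ := fun p => by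
    simp only [Matrix.mulVec, dotProduct]
    calc |∑ b, H p b * u b| ≤ ∑ b, |H p b * u b| := Finset.abs_sum_le_sum_abs _ _
      _ ≤ ∑ b, |H p b| * ‖u‖ := Finset.sum_le_sum fun b _ => by
          rw [abs_mul]
          refine mul_le_mul_of_nonneg_left ?_ (abs_nonneg _)
          have h := norm_le_pi_norm u b
          rwa [Real.norm_eq_abs] at h
      _ = (∑ b, |H p b|) * ‖u‖ := (Finset.sum_mul _ _ _).symm
      _ ≤ cH * ‖u‖ := mul_le_mul_of_nonneg_right (hH p) (norm_nonneg _)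
  have hsq : ∀ p, ((H *ᵥ u) p) ^ 2 ≤ (cH * ‖u‖) ^ 2 := fun p => by
    rw [← sq_abs]
    exact pow_le_pow_left₀ (abs_nonneg _) (hcH p) 2
  calc ∑ p, ζ p * ((H *ᵥ u) p) ^ 2 ≤ ∑ p, ζ p * (cH * ‖u‖) ^ 2 :=
        Finset.sum_le_sum fun p _ => mul_le_mul_of_nonneg_left (hsq p) (hζ p)
    _ = (∑ p, ζ p) * (cH * ‖u‖) ^ 2 := (Finset.sum_mul _ _ _).symm
    _ ≤ Z * (cH * ‖u‖) ^ 2 := mul_le_mul_of_nonneg_right hZ (by positivity)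
    _ = Z * cH ^ 2 * ‖u‖ ^ 2 := by ring

/-- **CAUCHY's LETTER AT THE WINDOW RADIUS.**  Taking the analyticity width equal to the window in chart units,
`r = Φ∕c_H` (`Φ, c_H > 0`), the Cauchy letter `Mq = 2S∕r²` of ★★′ for the abelian remainder is EXACTLY
`16·e^{2gΦ}·(g·Φ·Z·c_H²)` — the real-variable road's letter `g·Φ·(Z c_H²)` (p607837 with §4's `c_φ`) times `16·e^{2gΦ}`.
[textbook] -/
theorem cauchyLetter_eq {g Φ cH Z : ℝ} (hΦ : 0 < Φ) (hcH : 0 < cH) :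
    2 * (g * (Φ + cH * (Φ / cH)) ^ 3 * Real.exp (g * (Φ + cH * (Φ / cH))) * Z) / (Φ / cH) ^ 2 =
      16 * Real.exp (2 * g * Φ) * (g * Φ * (Z * cH ^ 2)) := by
  have e : Φ + cH * (Φ / cH) = 2 * Φ := by field_simp; ring
  rw [e, show g * (2 * Φ) = 2 * g * Φ by ring]
  field_simp
  ring

/-- **SAME RATE, A NUMERICAL FACTOR**: on the real road's own window cap `2gΦ ≤ 1` the Cauchy letter at `r = Φ∕c_H` is at
most `16e·(g·Φ·Z·c_H²)` — both roads give a second-order letter of order `g¹·Φ` for the lattice cosine action; the analytic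
road pays the factor `16e ≈ 43.5` (and the diameter letter), the real road paid a hand computation (p606810 §1–§2).
A2 for ★★′: its NODE-O-shaped VALUE clause is not weaker in RATE than the sharp real row at a genuine lattice action.
[textbook] -/
theorem cauchyLetter_le_realLetter {g Φ cH Z : ℝ} (hg : 0 ≤ g) (hΦ : 0 < Φ) (hcH : 0 < cH) (hZ : 0 ≤ Z)
    (hcap : 2 * g * Φ ≤ 1) :
    2 * (g * (Φ + cH * (Φ / cH)) ^ 3 * Real.exp (g * (Φ + cH * (Φ / cH))) * Z) / (Φ / cH) ^ 2 ≤
      16 * Real.exp 1 * (g * Φ * (Z * cH ^ 2)) := by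
  rw [cauchyLetter_eq hΦ hcH]
  have h1 : Real.exp (2 * g * Φ) ≤ Real.exp 1 := Real.exp_le_exp.2 hcap
  have h0 : 0 ≤ g * Φ * (Z * cH ^ 2) := by positivity
  exact mul_le_mul_of_nonneg_right (mul_le_mul_of_nonneg_left h1 (by norm_num)) h0

/-- **THE ANALYTIC CLAUSE AT PRINT's BOOKKEEPING, AS A `g`-SMALLNESS LINE.**  With the window letter `Φ ≤ K·p₀(g_k)` of (1.2)
(support `χ({|B′| < M₀g_k⁻¹ε_k})`, `ε_k = g_kA₀p₀(g_k)`, `K = ‖∂H_{1,k}‖M₀A₀` as in `B16Txt357ThirdOrderU1.ineq12V_U1`), a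
fixed width `r ≥ 0`, the cap `g·(K p₀(g) + c_H r) ≤ 1` and the smallness
`16·d·(100M)^{d+1}·(e·Z·(K p₀(g) + c_H r)³)·g ≤ γ₀·r²` imply ★★★'s clause. [cite: Balaban1989LargeFieldII, (1.9) p.358] -/
theorem analyticClauseU1_of_smallness {g Φ K p₀g cH r Z γ₀ M : ℝ} {d : ℕ} (hg : 0 ≤ g)
    (hcH : 0 ≤ cH) (hr : 0 ≤ r) (hZ : 0 ≤ Z) (hM : 0 < M) (hΦ0 : 0 ≤ Φ) (hΦ : Φ ≤ K * p₀g)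
    (hcap : g * (K * p₀g + cH * r) ≤ 1)
    (hsmall : 16 * d * (100 * M) ^ (d + 1) * (Real.exp 1 * Z * (K * p₀g + cH * r) ^ 3) * g ≤ γ₀ * r ^ 2) :
    16 * d * (100 * M) ^ (d + 1) * (g * (Φ + cH * r) ^ 3 * Real.exp (g * (Φ + cH * r)) * Z) ≤ γ₀ * r ^ 2 := by
  have h1 : Φ + cH * r ≤ K * p₀g + cH * r := by linarith
  have h0 : 0 ≤ Φ + cH * r := by positivity
  have h2 : (Φ + cH * r) ^ 3 ≤ (K * p₀g + cH * r) ^ 3 := pow_le_pow_left₀ h0 h1 3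
  have h3 : Real.exp (g * (Φ + cH * r)) ≤ Real.exp 1 :=
    Real.exp_le_exp.2 ((mul_le_mul_of_nonneg_left h1 hg).trans hcap)
  have h4 : g * (Φ + cH * r) ^ 3 * Real.exp (g * (Φ + cH * r)) * Z ≤
      Real.exp 1 * Z * (K * p₀g + cH * r) ^ 3 * g := by
    calc g * (Φ + cH * r) ^ 3 * Real.exp (g * (Φ + cH * r)) * Z
        ≤ g * (K * p₀g + cH * r) ^ 3 * Real.exp 1 * Z := by
          have := mul_le_mul h2 h3 (Real.exp_nonneg _) ((pow_nonneg h0 3).trans h2)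
          have := mul_le_mul_of_nonneg_left this hg
          exact mul_le_mul_of_nonneg_right (by simpa [mul_assoc] using this) hZ
      _ = Real.exp 1 * Z * (K * p₀g + cH * r) ^ 3 * g := by ring
  calc 16 * d * (100 * M) ^ (d + 1) * (g * (Φ + cH * r) ^ 3 * Real.exp (g * (Φ + cH * r)) * Z)
      ≤ 16 * d * (100 * M) ^ (d + 1) * (Real.exp 1 * Z * (K * p₀g + cH * r) ^ 3 * g) :=
        mul_le_mul_of_nonneg_left h4 (by positivity)
    _ = 16 * d * (100 * M) ^ (d + 1) * (Real.exp 1 * Z * (K * p₀g + cH * r) ^ 3) * g := by ring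
    _ ≤ γ₀ * r ^ 2 := hsmall

/-- **"FOR `g_k` SUFFICIENTLY SMALL" ON THE ANALYTIC ROAD.**  If the window profile is nonnegative with `g·p₀(g)³ → 0` as
`g → 0⁺` (e.g. `p₀` a power of `log g⁻²`, [Balaban1988LargeFieldIII] (2.2)), then for a FIXED width `r > 0` both the cap
and the smallness line of `analyticClauseU1_of_smallness` hold eventually (`γ₀ > 0`; `K, c_H, Z ≥ 0`).
[cite: Balaban1989LargeFieldII, (1.9) p.358] -/
theorem eventually_analyticSmallnessU1 {K cH r Z γ₀ M : ℝ} {d : ℕ} (p₀ : ℝ → ℝ) (hp₀ : ∀ g, 0 ≤ p₀ g)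
    (hK : 0 ≤ K) (hcH : 0 ≤ cH) (hr : 0 < r) (hZ : 0 ≤ Z) (hM : 0 < M) (hγ₀ : 0 < γ₀)
    (hp : Filter.Tendsto (fun g => g * p₀ g ^ 3) (nhdsWithin 0 (Set.Ioi 0)) (nhds 0)) :
    ∀ᶠ g in nhdsWithin 0 (Set.Ioi 0), g * (K * p₀ g + cH * r) ≤ 1 ∧
      16 * d * (100 * M) ^ (d + 1) * (Real.exp 1 * Z * (K * p₀ g + cH * r) ^ 3) * g ≤ γ₀ * r ^ 2 := by
  -- the gauge `u g := g + g·p₀(g)³ → 0`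
  have hid : Filter.Tendsto (fun g : ℝ => g) (nhdsWithin 0 (Set.Ioi 0)) (nhds 0) :=
    Filter.tendsto_id.mono_left nhdsWithin_le_nhds
  have hu : Filter.Tendsto (fun g => g + g * p₀ g ^ 3) (nhdsWithin 0 (Set.Ioi 0)) (nhds 0) := by
    simpa using hid.add hp
  set C₁ : ℝ := K + cH * r with hC₁
  set C₂ : ℝ := 16 * d * (100 * M) ^ (d + 1) * (Real.exp 1 * Z * (4 * (K ^ 3 + (cH * r) ^ 3))) with hC₂
  have hC₁0 : 0 ≤ C₁ := by positivity
  have hC₂0 : 0 ≤ C₂ := by positivity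
  have e1 : ∀ᶠ g in nhdsWithin 0 (Set.Ioi 0), C₁ * (g + g * p₀ g ^ 3) ≤ 1 := by
    have h := hu.const_mul C₁
    rw [mul_zero] at h
    exact h.eventually_le_const one_pos
  have e2 : ∀ᶠ g in nhdsWithin 0 (Set.Ioi 0), C₂ * (g + g * p₀ g ^ 3) ≤ γ₀ * r ^ 2 := by
    have h := hu.const_mul C₂
    rw [mul_zero] at h
    exact h.eventually_le_const (by positivity)
  have e3 : ∀ᶠ g : ℝ in nhdsWithin 0 (Set.Ioi 0), g ∈ Set.Ioi (0 : ℝ) := eventually_mem_nhdsWithin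
  filter_upwards [e1, e2, e3] with g h1 h2 h3
  have hg : 0 ≤ g := le_of_lt h3
  -- `p₀ ≤ 1 + p₀³` for `p₀ ≥ 0`, hence `g·p₀ ≤ u g`
  have hp1 : p₀ g ≤ 1 + p₀ g ^ 3 := by
    rcases le_or_gt (p₀ g) 1 with h | h
    · linarith [pow_nonneg (hp₀ g) 3]
    · linarith [le_self_pow₀ h.le (by norm_num : (3 : ℕ) ≠ 0)]
  have hgp : g * p₀ g ≤ g + g * p₀ g ^ 3 := by nlinarith
  refine ⟨?_, ?_⟩
  · calc g * (K * p₀ g + cH * r) = K * (g * p₀ g) + cH * r * g := by ring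
      _ ≤ K * (g + g * p₀ g ^ 3) + cH * r * (g + g * p₀ g ^ 3) := by
          refine add_le_add (mul_le_mul_of_nonneg_left hgp hK) (mul_le_mul_of_nonneg_left ?_ (by positivity))
          nlinarith [pow_nonneg (hp₀ g) 3]
      _ = C₁ * (g + g * p₀ g ^ 3) := by rw [hC₁]; ring
      _ ≤ 1 := h1
  · have hcube : (K * p₀ g + cH * r) ^ 3 * g ≤ 4 * (K ^ 3 + (cH * r) ^ 3) * (g + g * p₀ g ^ 3) := by
      have ha : 0 ≤ K * p₀ g := mul_nonneg hK (hp₀ g)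
      have hb : 0 ≤ cH * r := by positivity
      -- `(a + b)³ ≤ 4(a³ + b³)` for `a, b ≥ 0` (the tree's `Literature.Analysis.FluidPDE.Torus.add_pow_three_le`, re-derived
      -- inline rather than importing a fluid-PDE module here)
      have hab3 : (K * p₀ g + cH * r) ^ 3 ≤ 4 * ((K * p₀ g) ^ 3 + (cH * r) ^ 3) := by
        nlinarith [mul_nonneg (mul_nonneg ha hb) (add_nonneg ha hb),
          mul_nonneg (sq_nonneg (K * p₀ g - cH * r)) (add_nonneg ha hb)]
      calc (K * p₀ g + cH * r) ^ 3 * g ≤ 4 * ((K * p₀ g) ^ 3 + (cH * r) ^ 3) * g :=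
            mul_le_mul_of_nonneg_right hab3 hg
        _ = 4 * (K ^ 3 * (g * p₀ g ^ 3) + (cH * r) ^ 3 * g) := by ring
        _ ≤ 4 * (K ^ 3 * (g + g * p₀ g ^ 3) + (cH * r) ^ 3 * (g + g * p₀ g ^ 3)) := by
            gcongr
            · nlinarith
            · nlinarith [pow_nonneg (hp₀ g) 3]
        _ = 4 * (K ^ 3 + (cH * r) ^ 3) * (g + g * p₀ g ^ 3) := by ring
    calc 16 * d * (100 * M) ^ (d + 1) * (Real.exp 1 * Z * (K * p₀ g + cH * r) ^ 3) * g
        = 16 * d * (100 * M) ^ (d + 1) * (Real.exp 1 * Z) * ((K * p₀ g + cH * r) ^ 3 * g) := by ring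
      _ ≤ 16 * d * (100 * M) ^ (d + 1) * (Real.exp 1 * Z) * (4 * (K ^ 3 + (cH * r) ^ 3) * (g + g * p₀ g ^ 3)) :=
          mul_le_mul_of_nonneg_left hcube (by positivity)
      _ = C₂ * (g + g * p₀ g ^ 3) := by rw [hC₂]; ring
      _ ≤ γ₀ * r ^ 2 := h2

/-- ★★★′ **THE ANALYTIC ROAD AT PRINT's LETTERS**: ★★★ with its clause discharged by `analyticClauseU1_of_smallness` — on a
convex window with `|(H *ᵥ v)_p| ≤ Φ ≤ K·p₀(g)` and diameter `< r`, under the cap `g·(K p₀(g) + c_H r) ≤ 1` and the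
smallness line `16·d·(100M)^{d+1}·(e·Z·(K p₀(g) + c_H r)³)·g ≤ γ₀·r²` (both eventual as `g → 0⁺`,
`eventually_analyticSmallnessU1`), the abelian (1.2) exponent is CONVEX. [cite: Balaban1989LargeFieldII, (1.9) p.358] -/
theorem convexOn_chartExponentU1_analytic_printLetters {K : Set (κ → ℝ)} (hK : Convex ℝ K) (φ : (κ → ℝ) → ℝ)
    (c : ℝ) (A : Matrix κ κ ℝ) (ℓ : (κ → ℝ) →ₗ[ℝ] ℝ) (H : Matrix ι κ ℝ) {ζ : ι → ℝ} (θ : ι → ℝ)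
    {g Φ Kw p₀g cH Z r γ₀ M : ℝ} {d : ℕ}
    (hg : 0 < g) (hΦ : 0 ≤ Φ) (hcH : 0 ≤ cH) (hr : 0 ≤ r) (hζ : ∀ p, 0 ≤ ζ p)
    (hZ : ∑ p, ζ p ≤ Z) (hZ0 : 0 ≤ Z) (hH : ∀ p, ∑ b, |H p b| ≤ cH) (hd : 1 ≤ d) (hM : 0 < M) (hγ₀ : 0 < γ₀)
    (hexp : ∀ v ∈ K, φ v = c + 1 / 2 * (v ⬝ᵥ (A *ᵥ v)) + ℓ v + 1 / g ^ 2 * V12 g ζ θ (H *ᵥ v))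
    (h19 : ∀ v, Ineq19 (v ⬝ᵥ (A *ᵥ v)) (∑ b, v b ^ 2) γ₀ d M)
    (hwin : ∀ v ∈ K, ∀ p, |(H *ᵥ v) p| ≤ Φ) (hΦK : Φ ≤ Kw * p₀g)
    (hdiam : ∀ x ∈ K, ∀ y ∈ K, ‖y - x‖ < r)
    (hcap : g * (Kw * p₀g + cH * r) ≤ 1)
    (hsmall : 16 * d * (100 * M) ^ (d + 1) * (Real.exp 1 * Z * (Kw * p₀g + cH * r) ^ 3) * g ≤ γ₀ * r ^ 2) :
    ConvexOn ℝ K φ :=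
  convexOn_chartExponentU1_analytic hK φ c A ℓ H θ hg hΦ hcH hζ hZ hH hd hM hγ₀ hexp h19 hwin hdiam
    (analyticClauseU1_of_smallness hg.le hcH hr hZ0 hM hΦ hΦK hcap hsmall)

end Rates

/-! ## §5  A6 ∕ A2 witness: every binder of ★★★ (hence of ★★′) inhabited by the one-plaquette lattice cosine action -/

section Witness

/-- **A6 WITNESS OF ★★★** (director-ym STANDING A6 RULE №189 (3)) — and A2 for dag-n21-w3 g3's ★★′: its NODE-O-shaped
binders (analyticity on complex `r`-balls, a VALUE row there, the diameter letter, the clause) are JOINTLY INHABITED by a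
genuine lattice action.  One bond ∕ one plaquette (`κ = ι = Fin 1`), chart `H = 1`, `A = 1`, `ℓ = 0`, `c = 0`, weight
`ζ = 1` (`Z = 1`), background `θ = 0`, `g = 1∕400`, window `K = B̄₁(0)` (`Φ = 1`, `c_H = 1`), width `r = 3` (`diam K ≤ 2`),
rows at `γ₀ = 1`, `d = 1`, `M = 1∕100`; the clause `16·S(1∕400, 1, 3) = 16·(64∕400)·e^{1∕100} ≤ 9` holds with room
(`e^{1∕100} ≤ e < 3`).  ★★★ fires: the one-plaquette action `½(v ⬝ᵥ v) + 400²·V12 (1∕400) 1 0 v` is CONVEX on the closed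
unit ball — certified through the complex road.  A satisfiability witness, not an estimate on Bałaban's measure.
[textbook] -/
theorem chartExponentU1_analytic_letters_inhabited :
    ConvexOn ℝ (closedBall (0 : Fin 1 → ℝ) 1) (fun v : Fin 1 → ℝ =>
      1 / 2 * (v ⬝ᵥ v) + 1 / (1 / 400) ^ 2 * V12 (1 / 400) (fun _ : Fin 1 => (1 : ℝ)) (fun _ => 0) v) := by
  refine convexOn_chartExponentU1_analytic (ι := Fin 1) (convex_closedBall _ _) _ 0 (1 : Matrix (Fin 1) (Fin 1) ℝ) 0
    (1 : Matrix (Fin 1) (Fin 1) ℝ) (ζ := fun _ => 1) (fun _ => 0) (g := 1 / 400) (Φ := 1) (cH := 1) (Z := 1) (r := 3)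
    (γ₀ := 1) (M := 1 / 100) (d := 1) (by norm_num) zero_le_one zero_le_one (fun _ => zero_le_one) (by simp) ?_
    le_rfl (by norm_num) one_pos ?_ ?_ ?_ ?_ ?_
  · -- hH: the row sum of the `1 × 1` identity matrix is `1`
    intro p
    obtain rfl : p = 0 := Subsingleton.elim p 0
    rw [Fin.sum_univ_one, Matrix.one_apply_eq, abs_one]
  · -- hexp
    intro v _
    rw [Matrix.one_mulVec, LinearMap.zero_apply]
    ring
  · -- h19 (1.9) as a real inequality: `1∕(2·1·1²)·Σ_b v_b² ≤ v ⬝ᵥ v`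
    intro v
    unfold Ineq19
    rw [Matrix.one_mulVec]
    simp only [dotProduct, Fin.sum_univ_one, Nat.cast_one]
    norm_num
    nlinarith [sq_nonneg (v 0)]
  · -- hwin: `|(1 *ᵥ v)_p| = |v_p| ≤ ‖v‖ ≤ 1` on the closed unit ball
    intro v hv p
    rw [Matrix.one_mulVec]
    have h1 : ‖v p‖ ≤ ‖v‖ := norm_le_pi_norm v p
    rw [Real.norm_eq_abs] at h1
    exact h1.trans (mem_closedBall_zero_iff.mp hv)
  · -- hdiam: `‖y − x‖ ≤ 2 < 3` on the closed unit ball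
    intro x hx y hy
    calc ‖y - x‖ ≤ ‖y‖ + ‖x‖ := norm_sub_le _ _
      _ ≤ 1 + 1 := add_le_add (mem_closedBall_zero_iff.mp hy) (mem_closedBall_zero_iff.mp hx)
      _ < 3 := by norm_num
  · -- the clause: `16·1·1²·((1∕400)·4³·e^{4∕400}·1) ≤ 1·3²`, from `e^{1∕100} ≤ e ≤ 3`
    have he : Real.exp (1 / 400 * (1 + 1 * 3)) ≤ 3 :=
      (Real.exp_le_exp.2 (by norm_num)).trans (Real.exp_one_lt_d9.le.trans (by norm_num))
    have h0 : 0 ≤ Real.exp (1 / 400 * (1 + 1 * 3)) := Real.exp_nonneg _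
    norm_num at he h0 ⊢
    nlinarith

end Witness

end Summit.QuantumFields.YangMills.Theorems.N21ChartExponentAnalyticU1Rates
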